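import Summits.CriticalPhenomena.PercolationContinuityZ3.Theorems.Transplant.GrigorchukSectionsDefs
import Summits.CriticalPhenomena.PercolationContinuityZ3.Theorems.Transplant.GrigorchukNormalForms
import Summits.CriticalPhenomena.PercolationContinuityZ3.Theorems.Transplant.GrigorchukBurnside
import Mathlib.GroupTheory.Schreier
import Mathlib.GroupTheory.Index
import Mathlib.GroupTheory.Finiteness
import HarnessLib

/-!
# The LEVEL-ONE RIGID STABILISERS of the first Grigorchuk group: two elementwise-commuting, trivially-intersecting subgroups of `𝔊`, each INFINITE and
# FINITELY GENERATED (via the sections and the normal closure `B = ⟨b⟩^𝔊`, `[𝔊 : B] ≤ 8`) — the algebraic input of Muchnik–Pak's `p_c < 1` for `𝔊`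

builds on p205010 (kernel theorem, internal audit signed; external expert review pending) — nothing in this file uses p205010; pure group theory, no percolation
statement, no node touched.  Lane `prim-bschramm`, seat `prim-bschramm-gen-1` gen 8 (GEN pen; offer O-MP file F-MP1, lead g25 GO 2026-08-28T04:34Z).  DEFINITION LANE
(review-queued): the two subgroups `rist i` (in `Perm(Ray)`) / `ristG i` (in `𝔊`), the four generators `aG bG cG dG` as elements of the subtype `↥grigorchukGroup`, the
normal closure `normalClosureB`, and the section homomorphism `secR i` on a rigid stabiliser; everything else is theorems.  Helper file (`--supports stmt-CriticalPhenomena-4575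
--as helper`).  No instance, no notation; no new copy of `𝔊` (the tree's `Grigorchuk.grigorchukGroup`, «GrigorchukLamplighterDefs» p581401, with the section calculus of
«GrigorchukSectionsDefs» p590401, the Klein table of «GrigorchukNormalForms» p590723, `exists_sec_eq` of «GrigorchukLevelTransitive» p593398 and
`grigorchukGroup_infinite` of «GrigorchukBurnside» p594312 — all imported, nothing restated).  NOTHING about growth
or amenability of `𝔊`; the word 'branch' is not claimed beyond the facts typed here.

CONTENT (Γ := `↥grigorchukGroup`; `ψ = (sec 0, sec 1)` the level-one sections):
* §1 `rist i ≤ Perm(Ray)`: permutations fixing every ray NOT beginning with the letter `i` (support inside the subtree `i`).  `rist i ≤ stabOne`; elements of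
  `rist false` and `rist true` COMMUTE and meet trivially; the other section of an element of `rist i` is trivial; `d ∈ rist true`, `a d a ∈ rist false`.
* §2 `ristG i := rist i ⊓ 𝔊` as a subgroup of Γ, and the SECTION HOMOMORPHISM `secR i : ristG i →* Γ` (`sec_mem_grigorchukGroup`), INJECTIVE (`eq_of_sec_eq`).
* §3 the range of `secR i` is a NORMAL subgroup of Γ (the sections map `St_𝔊(1)` ONTO `𝔊` — «GrigorchukLevelTransitive» `exists_sec_eq`, p593398 —
  so conjugating the lift by a preimage conjugates the section) containing `b` (`b = φ₁(d) = φ₀(ada)`), so it contains the normal closure `B = ⟨b⟩^Γ`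
  (`normalClosureB_le_range_secR`) — i.e. `B × B ≤ ψ(St_𝔊(1))`.
* §4 `[Γ : B] ≤ 8`: `c = b d` (Klein), `(ad)⁴ = 1` BY SECTIONS (`ψ(adad) = (b, b)`), so every element of Γ lies in `B · (ad)^i a^j`, `i < 4`, `j < 2`
  (right closure induction); `B.FiniteIndex`.
* §5 Γ is finitely generated (the literal closure) and infinite (p594312); so the range of `secR i` — finite index over `B` — is finitely generated (Schreier, Mathlib)
  and infinite, and so is `ristG i ≅ range` : **`ristG_fg`, `ristG_infinite`, `commute_of_mem_ristG`, `eq_one_of_mem_ristG`** — literally the hypotheses of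
  «CayleyProductCriticalProbLtOne» `CayleyProd.criticalProb_lt_one_of_commuting_subgroups` (p394607), met in the customer file «GrigorchukCriticalProbLtOne».
[cite: Grigorchuk1980, definition of a, b, c, d; relations b = (a,c), c = (a,d), d = (1,b)] [cite: BartholdiErschler2012, §3.1 (wreath recursion, St(1), ψ injective)]
[cite: MuchnikPak2001, Lemma 2 and Cor. 1 (Grigorchuk groups contain a product of two infinite finitely generated subgroups)]
-/

noncomputable section

namespace Summit.CriticalPhenomena.PercolationContinuityZ3.Theorems.Transplant

namespace Grigorchuk

open scoped Classical

/-! ## §1 Rigid stabilisers of the two level-one subtrees, in `Perm(Ray)` -/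

/-- **The rigid stabiliser of the level-one subtree `i`**: permutations of rays fixing every ray that does NOT begin with `i` (so supported inside the
subtree of rays beginning with `i`). [cite: BartholdiErschler2012, §3.1 (the action on the binary tree)] [cite: MuchnikPak2001, Lemma 2] -/
def rist (i : Bool) : Subgroup (Equiv.Perm Ray) where
  carrier := {g | ∀ x : Ray, x 0 ≠ i → g x = x}
  one_mem' := fun _ _ => rfl
  mul_mem' := fun {g h} hg hh x hx => by rw [Equiv.Perm.mul_apply, hh x hx, hg x hx]
  inv_mem' := fun {g} hg x hx => by rw [Equiv.Perm.inv_eq_iff_eq]; exact (hg x hx).symm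

/-- Membership in `rist i`. [folklore] -/
theorem mem_rist {i : Bool} {g : Equiv.Perm Ray} : g ∈ rist i ↔ ∀ x : Ray, x 0 ≠ i → g x = x := Iff.rfl

/-- An element of `rist i` maps rays beginning with `i` to rays beginning with `i` (it permutes the complement of its fixed set). [folklore] -/
theorem apply_zero_of_mem_rist {i : Bool} {g : Equiv.Perm Ray} (hg : g ∈ rist i) (x : Ray) : g x 0 = x 0 := by
  by_cases hx : x 0 = i
  · by_contra hne
    rw [hx] at hne
    -- `g x` does not begin with `i`, so `g` fixes it; injectivity gives `g x = x`, contradiction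
    have h1 : g (g x) = g x := hg (g x) hne
    have h2 : g x = x := g.injective h1
    exact hne (by rw [h2, hx])
  · rw [hg x hx]

/-- `rist i ≤ St(1)`: rigid stabilisers preserve the first letter. [cite: BartholdiErschler2012, §3.1] -/
theorem rist_le_stabOne (i : Bool) : rist i ≤ stabOne := fun _ hg x => apply_zero_of_mem_rist hg x

/-- **Elements of the two rigid stabilisers commute.** [cite: MuchnikPak2001, Lemma 2 (the two factors commute)] -/
theorem commute_of_mem_rist {g h : Equiv.Perm Ray} (hg : g ∈ rist false) (hh : h ∈ rist true) : Commute g h := by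
  refine Equiv.ext fun x => ?_
  change g (h x) = h (g x)
  cases h0 : x 0
  · -- `x` begins with `0`: `h` fixes `x` and `g x`
    have hx : h x = x := hh x (by rw [h0]; decide)
    have hgx : h (g x) = g x := hh (g x) (by rw [apply_zero_of_mem_rist hg, h0]; decide)
    rw [hx, hgx]
  · have hx : g x = x := hg x (by rw [h0]; decide)
    have hhx : g (h x) = h x := hg (h x) (by rw [apply_zero_of_mem_rist hh, h0]; decide)
    rw [hx, hhx]

/-- **The two rigid stabilisers meet trivially.** [folklore] -/
theorem eq_one_of_mem_rist {g : Equiv.Perm Ray} (h0 : g ∈ rist false) (h1 : g ∈ rist true) : g = 1 := by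
  refine Equiv.ext fun x => ?_
  cases hx : x 0
  · exact h1 x (by rw [hx]; decide)
  · exact h0 x (by rw [hx]; decide)

/-- The OTHER section of an element of `rist i` is trivial: `sec (¬i) g = 1`. [cite: BartholdiErschler2012, §3.1 (sections)] -/
theorem sec_not_eq_one {i : Bool} {g : Equiv.Perm Ray} (hg : g ∈ rist i) :
    sec (!i) ⟨g, rist_le_stabOne i hg⟩ = 1 := by
  ext y n
  rw [sec_apply]
  change tail (g (cons (!i) y)) n = y n
  have h0 : cons (!i) y 0 = !i := rfl
  rw [hg (cons (!i) y) (by rw [h0]; cases i <;> decide), tail_cons]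

/-- An element of `rist i` is determined by its `i`-section. [cite: BartholdiErschler2012, §3.1 (ψ injective)] -/
theorem eq_of_mem_rist_of_sec_eq {i : Bool} {g h : Equiv.Perm Ray} (hg : g ∈ rist i) (hh : h ∈ rist i)
    (e : sec i ⟨g, rist_le_stabOne i hg⟩ = sec i ⟨h, rist_le_stabOne i hh⟩) : g = h := by
  have hn : sec (!i) ⟨g, rist_le_stabOne i hg⟩ = sec (!i) ⟨h, rist_le_stabOne i hh⟩ := by rw [sec_not_eq_one hg, sec_not_eq_one hh]
  have key : (⟨g, rist_le_stabOne i hg⟩ : ↥stabOne) = ⟨h, rist_le_stabOne i hh⟩ := by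
    cases i
    · exact eq_of_sec_eq e hn
    · exact eq_of_sec_eq hn e
  exact congrArg Subtype.val key

/-- Conjugating an element of `rist i` by an element of `St(1)` stays in `rist i`. [cite: BartholdiErschler2012, §3.1] -/
theorem conj_mem_rist {i : Bool} {g h : Equiv.Perm Ray} (hg : g ∈ rist i) (hh : h ∈ stabOne) : h * g * h⁻¹ ∈ rist i := by
  intro x hx
  have hx' : (h⁻¹ x) 0 ≠ i := by rwa [mem_stabOne.1 (stabOne.inv_mem hh) x]
  rw [Equiv.Perm.mul_apply, Equiv.Perm.mul_apply, hg _ hx']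
  exact h.apply_symm_apply x

/-- `d ∈ rist 1`: `d` acts trivially on rays beginning with `0` (`ψ(d) = (1, b)`). [cite: Grigorchuk1980, relation d = (1, b)] -/
theorem genD_mem_rist : genD ∈ rist true := by
  intro x hx
  have h0 : x 0 = false := by cases h : x 0 <;> simp_all
  rw [← cons_head_tail x, h0, genD_cons_false]

/-- `a d a ∈ rist 0` (`ψ(ada) = (b, 1)`). [cite: Grigorchuk1980, relation d = (1, b); a swaps the two subtrees] -/
theorem conj_genD_mem_rist : genA * genD * genA ∈ rist false := by
  intro x hx
  have h0 : x 0 = true := by cases h : x 0 <;> simp_all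
  rw [← cons_head_tail x, h0, Equiv.Perm.mul_apply, Equiv.Perm.mul_apply, genA_cons, Bool.not_true, genD_cons_false, genA_cons,
    Bool.not_false]

/-! ## §2 The rigid stabilisers inside `𝔊`, and the section homomorphism on them -/

/-- `a` as an element of `𝔊`. [cite: Grigorchuk1980, definition of the group] -/
def aG : ↥grigorchukGroup := ⟨genA, Subgroup.subset_closure (by simp)⟩
/-- `b` as an element of `𝔊`. [cite: Grigorchuk1980, definition of the group] -/
def bG : ↥grigorchukGroup := ⟨genB, Subgroup.subset_closure (by simp)⟩
/-- `c` as an element of `𝔊`. [cite: Grigorchuk1980, definition of the group] -/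
def cG : ↥grigorchukGroup := ⟨genC, Subgroup.subset_closure (by simp)⟩
/-- `d` as an element of `𝔊`. [cite: Grigorchuk1980, definition of the group] -/
def dG : ↥grigorchukGroup := ⟨genD, Subgroup.subset_closure (by simp)⟩

/-- **`𝔊 = ⟨a, b, c, d⟩` as a subgroup of itself.** [cite: Grigorchuk1980, definition of the group] -/
theorem closure_gens_eq_top : Subgroup.closure ({aG, bG, cG, dG} : Set ↥grigorchukGroup) = ⊤ := by
  have h := Subgroup.closure_closure_coe_preimage (k := ({genA, genB, genC, genD} : Set (Equiv.Perm Ray)))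
  refine eq_top_iff.2 (le_trans (eq_top_iff.1 h) (Subgroup.closure_mono ?_))
  intro g hg
  have hg' : (g : Equiv.Perm Ray) ∈ ({genA, genB, genC, genD} : Set (Equiv.Perm Ray)) := hg
  simp only [Set.mem_insert_iff, Set.mem_singleton_iff] at hg' ⊢
  rcases hg' with h | h | h | h
  · exact Or.inl (Subtype.ext h)
  · exact Or.inr (Or.inl (Subtype.ext h))
  · exact Or.inr (Or.inr (Or.inl (Subtype.ext h)))
  · exact Or.inr (Or.inr (Or.inr (Subtype.ext h)))

/-- **The rigid stabiliser of the subtree `i` in `𝔊`**: `ristG i = rist i ⊓ 𝔊`, as a subgroup of `Γ = ↥grigorchukGroup`.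
[cite: MuchnikPak2001, Lemma 2] [cite: BartholdiErschler2012, §3.1] -/
def ristG (i : Bool) : Subgroup ↥grigorchukGroup := (rist i).comap grigorchukGroup.subtype

/-- Membership in `ristG i`. [folklore] -/
theorem mem_ristG {i : Bool} {g : ↥grigorchukGroup} : g ∈ ristG i ↔ (g : Equiv.Perm Ray) ∈ rist i := Iff.rfl

/-- **Elements of `ristG 0` and `ristG 1` commute.** [cite: MuchnikPak2001, Lemma 2] -/
theorem commute_of_mem_ristG {g h : ↥grigorchukGroup} (hg : g ∈ ristG false) (hh : h ∈ ristG true) : Commute g h :=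
  Subtype.ext (commute_of_mem_rist hg hh).eq

/-- **`ristG 0 ⊓ ristG 1 = 1`.** [folklore] -/
theorem eq_one_of_mem_ristG {g : ↥grigorchukGroup} (h0 : g ∈ ristG false) (h1 : g ∈ ristG true) : g = 1 :=
  Subtype.ext (eq_one_of_mem_rist h0 h1)

/-- `d ∈ ristG 1`, `a d a ∈ ristG 0`. [cite: Grigorchuk1980, relation d = (1, b)] -/
theorem dG_mem_ristG : dG ∈ ristG true ∧ aG * dG * aG ∈ ristG false := ⟨genD_mem_rist, conj_genD_mem_rist⟩

/-- **The section homomorphism `secR i : ristG i → 𝔊`**, `g ↦ sec i g` (sections of elements of `St_𝔊(1)` lie in `𝔊`, p590401).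
[cite: BartholdiErschler2012, §3.1 (ψ : St(1) → G × G)] -/
def secR (i : Bool) : ↥(ristG i) →* ↥grigorchukGroup where
  toFun g := ⟨sec i ⟨((g : ↥grigorchukGroup) : Equiv.Perm Ray), rist_le_stabOne i g.2⟩,
    sec_mem_grigorchukGroup ⟨((g : ↥grigorchukGroup) : Equiv.Perm Ray), rist_le_stabOne i g.2⟩ (g : ↥grigorchukGroup).2 i⟩
  map_one' := Subtype.ext (by
    change sec i ⟨(1 : Equiv.Perm Ray), _⟩ = 1
    exact map_one (sec i))
  map_mul' g h := Subtype.ext (by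
    change sec i ⟨((g : ↥grigorchukGroup) : Equiv.Perm Ray) * ((h : ↥grigorchukGroup) : Equiv.Perm Ray), _⟩ = _
    exact map_mul (sec i) ⟨_, rist_le_stabOne i g.2⟩ ⟨_, rist_le_stabOne i h.2⟩)

/-- Unfolding `secR`. [folklore] -/
theorem coe_secR (i : Bool) (g : ↥(ristG i)) :
    ((secR i g : ↥grigorchukGroup) : Equiv.Perm Ray) = sec i ⟨((g : ↥grigorchukGroup) : Equiv.Perm Ray), rist_le_stabOne i g.2⟩ := rfl

/-- **`secR i` is injective** (an element of a rigid stabiliser is determined by its one non-trivial section). [cite: BartholdiErschler2012, §3.1 (ψ injective)] -/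
theorem secR_injective (i : Bool) : Function.Injective (secR i) := by
  intro g h e
  have e' := congrArg (fun γ : ↥grigorchukGroup => (γ : Equiv.Perm Ray)) e
  simp only [coe_secR] at e'
  exact Subtype.ext (Subtype.ext (eq_of_mem_rist_of_sec_eq g.2 h.2 e'))

/-! ## §3 The range of `secR i` is normal and contains `B = ⟨b⟩^𝔊` (the sections map `St_𝔊(1)` ONTO `𝔊`: «GrigorchukLevelTransitive» `exists_sec_eq`, p593398) -/

/-- **The range of `secR i` is a NORMAL subgroup of `𝔊`**: conjugating the lift by a `St_𝔊(1)`-preimage of `γ` under `φᵢ` conjugates the section by `γ`.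
[cite: BartholdiErschler2012, §3.1] [cite: MuchnikPak2001, Lemma 2] -/
theorem range_secR_normal (i : Bool) : (secR i).range.Normal := by
  refine ⟨fun n hn γ => ?_⟩
  obtain ⟨g, rfl⟩ := hn
  -- a preimage `H ∈ St_𝔊(1)` of `γ` under `φᵢ` (the sections are onto, p593398)
  obtain ⟨H, hH, eH⟩ := exists_sec_eq i γ.2
  have hmem : (H : Equiv.Perm Ray) * ((g : ↥grigorchukGroup) : Equiv.Perm Ray) * (H : Equiv.Perm Ray)⁻¹ ∈ rist i := conj_mem_rist g.2 H.2
  let g' : ↥(ristG i) := ⟨⟨(H : Equiv.Perm Ray) * ((g : ↥grigorchukGroup) : Equiv.Perm Ray) * (H : Equiv.Perm Ray)⁻¹,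
    grigorchukGroup.mul_mem (grigorchukGroup.mul_mem hH (g : ↥grigorchukGroup).2) (grigorchukGroup.inv_mem hH)⟩, hmem⟩
  refine ⟨g', Subtype.ext ?_⟩
  rw [coe_secR, Subgroup.coe_mul, Subgroup.coe_mul, Subgroup.coe_inv, coe_secR, ← eH]
  have e : (⟨(H : Equiv.Perm Ray) * ((g : ↥grigorchukGroup) : Equiv.Perm Ray) * (H : Equiv.Perm Ray)⁻¹, rist_le_stabOne i hmem⟩ : ↥stabOne) =
      H * ⟨((g : ↥grigorchukGroup) : Equiv.Perm Ray), rist_le_stabOne i g.2⟩ * H⁻¹ := rfl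
  change sec i ⟨(H : Equiv.Perm Ray) * ((g : ↥grigorchukGroup) : Equiv.Perm Ray) * (H : Equiv.Perm Ray)⁻¹, rist_le_stabOne i hmem⟩ = _
  rw [e, map_mul, map_mul, map_inv]

/-- `b` lies in the range of `secR i` (`b = φ₁(d) = φ₀(ada)`). [cite: Grigorchuk1980, relation d = (1, b)] -/
theorem bG_mem_range_secR (i : Bool) : bG ∈ (secR i).range := by
  cases i
  · refine ⟨⟨aG * dG * aG, dG_mem_ristG.2⟩, Subtype.ext ?_⟩
    rw [coe_secR]
    change sec false ⟨genA * genD * genA, _⟩ = genB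
    rw [show (⟨genA * genD * genA, _⟩ : ↥stabOne) = ⟨genA * (dSt : Equiv.Perm Ray) * genA, conj_genA_mem_stabOne dSt.2⟩ from rfl,
      sec_conj_genA, Bool.not_false, sec_dSt.2]
  · refine ⟨⟨dG, dG_mem_ristG.1⟩, Subtype.ext ?_⟩
    rw [coe_secR]
    change sec true ⟨genD, _⟩ = genB
    rw [show (⟨genD, _⟩ : ↥stabOne) = dSt from rfl, sec_dSt.2]

/-- **The normal closure `B = ⟨b⟩^𝔊`** of `b` in `Γ = ↥grigorchukGroup`. [cite: BartholdiErschler2012, §3.1 (the subgroup B = ⟨b⟩^G)] -/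
def normalClosureB : Subgroup ↥grigorchukGroup := Subgroup.normalClosure {bG}

/-- **`B ≤ range (secR i)`: every element of `⟨b⟩^𝔊` is the non-trivial section of an element of the rigid stabiliser `ristG i`** (`B × B ≤ ψ(St_𝔊(1))`).
[cite: BartholdiErschler2012, §3.1] [cite: MuchnikPak2001, Lemma 2] -/
theorem normalClosureB_le_range_secR (i : Bool) : normalClosureB ≤ (secR i).range := by
  haveI := range_secR_normal i
  exact Subgroup.normalClosure_le_normal (by simpa using bG_mem_range_secR i)

/-! ## §4 `[𝔊 : B] ≤ 8` -/

/-- `a² = 1`, `d² = 1`, `c = b d` in `Γ`. [cite: Grigorchuk1980, a² = b² = c² = d² = bcd = 1] -/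
theorem gens_relations : aG * aG = 1 ∧ dG * dG = 1 ∧ cG = bG * dG := by
  refine ⟨Subtype.ext (Equiv.ext fun x => flipAt_involutive 0 x), Subtype.ext ?_, Subtype.ext ?_⟩
  · change genD * genD = 1; exact (V4.toPerm_mul .d .d).symm
  · change genC = genB * genD; exact V4.toPerm_mul .b .d

/-- **`(ad)⁴ = 1` in `Γ`, BY SECTIONS** (proof-local: the `Perm`-level relation is «GrigorchukLamplighterShortCycles» `ad_pow_four`, p3 g36):
`adad ∈ St(1)` with `ψ(adad) = (b, b)`, so `ψ((adad)²) = (1, 1)` and `ψ` is injective.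
[cite: Grigorchuk1980, relation (ad)⁴ = 1] [cite: BartholdiErschler2012, §3.1 (ψ injective)] -/
private theorem aG_dG_pow_four : (aG * dG) ^ 4 = 1 := by
  have had : genA * genD * genA ∈ stabOne := conj_genA_mem_stabOne genD_mem_stabOne
  have hbb : genB * genB = 1 := (V4.toPerm_mul .b .b).symm
  have hconj : (⟨genA * genD * genA, had⟩ : ↥stabOne) = ⟨genA * (dSt : Equiv.Perm Ray) * genA, conj_genA_mem_stabOne dSt.2⟩ := rfl
  have hu0 : sec false ((⟨genA * genD * genA, had⟩ : ↥stabOne) * dSt) = genB := by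
    rw [map_mul, hconj, sec_conj_genA, Bool.not_false, sec_dSt.2, sec_dSt.1, mul_one]
  have hu1 : sec true ((⟨genA * genD * genA, had⟩ : ↥stabOne) * dSt) = genB := by
    rw [map_mul, hconj, sec_conj_genA, Bool.not_true, sec_dSt.1, sec_dSt.2, one_mul]
  -- `ψ((adad)²) = (b², b²) = (1, 1)`, and `ψ` is injective
  have huu : ((⟨genA * genD * genA, had⟩ : ↥stabOne) * dSt) * ((⟨genA * genD * genA, had⟩ : ↥stabOne) * dSt) = 1 :=
    eq_of_sec_eq (by rw [map_mul, hu0, map_one, hbb]) (by rw [map_mul, hu1, map_one, hbb])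
  have e : genA * genD * genA * genD * (genA * genD * genA * genD) = 1 := congrArg Subtype.val huu
  refine Subtype.ext ?_
  change (genA * genD) ^ 4 = 1
  rw [show (4 : ℕ) = 2 + 2 from rfl, pow_add, pow_two]
  simpa only [mul_assoc] using e

/-- **Coset enumeration: every `γ ∈ 𝔊` lies in `B · (ad)^i a^j` with `i < 4`, `j < 2`** (right closure induction over the generators: `b` is absorbed by the
normal subgroup `B`, `c = b d`, and `{(ad)^i a^j}` is closed under right multiplication by `a` and `d`). [cite: BartholdiErschler2012, §3.1 ([G : B] = 8)] -/
theorem exists_rep_mod_normalClosureB (γ : ↥grigorchukGroup) :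
    ∃ i < 4, ∃ j < 2, γ * ((aG * dG) ^ i * aG ^ j)⁻¹ ∈ normalClosureB := by
  obtain ⟨ha, hd, hc⟩ := gens_relations
  have hγ : γ ∈ Subgroup.closure ({aG, bG, cG, dG} : Set ↥grigorchukGroup) := by rw [closure_gens_eq_top]; trivial
  haveI : normalClosureB.Normal := Subgroup.normalClosure_normal
  have hbB : bG ∈ normalClosureB := Subgroup.subset_normalClosure (Set.mem_singleton bG)
  have ha' : aG⁻¹ = aG := inv_eq_of_mul_eq_one_right ha
  have hd' : dG⁻¹ = dG := inv_eq_of_mul_eq_one_right hd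
  -- `(ad)^(n % 4) = (ad)^n`
  have hmod : ∀ n : ℕ, (aG * dG) ^ (n % 4) = (aG * dG) ^ n := fun n => by
    conv_rhs => rw [← Nat.mod_add_div n 4, pow_add, pow_mul, aG_dG_pow_four, one_pow, mul_one]
  -- right multiplication by `a`: `(ad)^i a^j · a = (ad)^i a^(j+1)`
  have stepA : ∀ δ : ↥grigorchukGroup, (∃ i < 4, ∃ j < 2, δ * ((aG * dG) ^ i * aG ^ j)⁻¹ ∈ normalClosureB) →
      ∃ i < 4, ∃ j < 2, δ * aG * ((aG * dG) ^ i * aG ^ j)⁻¹ ∈ normalClosureB := by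
    rintro δ ⟨i, hi, j, hj, h⟩
    interval_cases j
    · refine ⟨i, hi, 1, by omega, ?_⟩
      rw [pow_zero, mul_one] at h
      rwa [pow_one, mul_inv_rev, ha', ← mul_assoc, mul_assoc δ aG aG, ha, mul_one]
    · refine ⟨i, hi, 0, by omega, ?_⟩
      rw [pow_one, mul_inv_rev, ha', ← mul_assoc] at h
      rwa [pow_zero, mul_one]
  -- right multiplication by `d`: `(ad)^i a · d = (ad)^(i+1)`, `(ad)^i · d = (ad)^(i+3) a` (from `d = (ad)^3 a`)
  have h3 : dG = (aG * dG) ^ 3 * aG := by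
    have e2 : (aG * dG) ^ 3 * aG * dG * dG = dG := by rw [mul_assoc ((aG * dG) ^ 3), ← pow_succ, aG_dG_pow_four, one_mul]
    rw [mul_assoc, hd, mul_one] at e2
    exact e2.symm
  have stepD : ∀ δ : ↥grigorchukGroup, (∃ i < 4, ∃ j < 2, δ * ((aG * dG) ^ i * aG ^ j)⁻¹ ∈ normalClosureB) →
      ∃ i < 4, ∃ j < 2, δ * dG * ((aG * dG) ^ i * aG ^ j)⁻¹ ∈ normalClosureB := by
    rintro δ ⟨i, hi, j, hj, h⟩
    -- `δ = β r` with `β ∈ B`; `δ d = β (r d)` and `r d` is again a representative `r'`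
    have key : ∀ r' : ↥grigorchukGroup, (aG * dG) ^ i * aG ^ j * dG = r' → δ * dG * r'⁻¹ ∈ normalClosureB := by
      rintro r' rfl
      rwa [mul_inv_rev, ← mul_assoc, mul_assoc δ, mul_inv_cancel, mul_one]
    interval_cases j
    · refine ⟨(i + 3) % 4, Nat.mod_lt _ (by omega), 1, by omega, key _ ?_⟩
      rw [pow_zero, mul_one, pow_one, hmod, pow_add, mul_assoc, ← h3]
    · refine ⟨(i + 1) % 4, Nat.mod_lt _ (by omega), 0, by omega, key _ ?_⟩
      rw [pow_one, pow_zero, mul_one, hmod, pow_succ, mul_assoc]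
  -- right multiplication by an element of `B` (e.g. `b`)
  have stepB : ∀ δ β : ↥grigorchukGroup, β ∈ normalClosureB → (∃ i < 4, ∃ j < 2, δ * ((aG * dG) ^ i * aG ^ j)⁻¹ ∈ normalClosureB) →
      ∃ i < 4, ∃ j < 2, δ * β * ((aG * dG) ^ i * aG ^ j)⁻¹ ∈ normalClosureB := by
    rintro δ β hβ ⟨i, hi, j, hj, h⟩
    refine ⟨i, hi, j, hj, ?_⟩
    set r : ↥grigorchukGroup := (aG * dG) ^ i * aG ^ j
    -- `δ β r⁻¹ = (δ r⁻¹) · (r β r⁻¹)`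
    have e : δ * β * r⁻¹ = δ * r⁻¹ * (r * β * r⁻¹) := by group
    rw [e]
    exact normalClosureB.mul_mem h (Subgroup.Normal.conj_mem inferInstance β hβ r)
  induction hγ using Subgroup.closure_induction_right with
  | one => exact ⟨0, by omega, 0, by omega, by rw [pow_zero, pow_zero, mul_one, inv_one, mul_one]; exact normalClosureB.one_mem⟩
  | mul_right x _ y hy ih =>
    simp only [Set.mem_insert_iff, Set.mem_singleton_iff] at hy
    rcases hy with rfl | rfl | rfl | rfl
    · exact stepA x ih
    · exact stepB x bG hbB ih
    · rw [hc, ← mul_assoc]; exact stepD _ (stepB x bG hbB ih)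
    · exact stepD x ih
  | mul_inv_cancel x _ y hy ih =>
    -- the generators are involutions (`c⁻¹ = d⁻¹ b⁻¹ = d b`, handled via `b`, `d` separately)
    simp only [Set.mem_insert_iff, Set.mem_singleton_iff] at hy
    rcases hy with rfl | rfl | rfl | rfl
    · rw [inv_eq_of_mul_eq_one_right ha]; exact stepA x ih
    · exact stepB x bG⁻¹ (normalClosureB.inv_mem hbB) ih
    · rw [hc, mul_inv_rev, inv_eq_of_mul_eq_one_right hd, ← mul_assoc]
      exact stepB _ bG⁻¹ (normalClosureB.inv_mem hbB) (stepD x ih)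
    · rw [inv_eq_of_mul_eq_one_right hd]; exact stepD x ih

/-- **`[𝔊 : B] < ∞`** (indeed `≤ 8`): the eight representatives `(ad)^i a^j` exhaust `𝔊 ⧸ B`. [cite: BartholdiErschler2012, §3.1 ([G : B] = 8)] -/
theorem normalClosureB_finiteIndex : normalClosureB.FiniteIndex := by
  haveI : normalClosureB.Normal := Subgroup.normalClosure_normal
  haveI : Finite (↥grigorchukGroup ⧸ normalClosureB) := by
    refine Finite.of_surjective (fun p : Fin 4 × Fin 2 => (QuotientGroup.mk ((aG * dG) ^ (p.1 : ℕ) * aG ^ (p.2 : ℕ)) : ↥grigorchukGroup ⧸ normalClosureB))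
      fun q => ?_
    induction q using QuotientGroup.induction_on with
    | H γ =>
      obtain ⟨i, hi, j, hj, h⟩ := exists_rep_mod_normalClosureB γ
      refine ⟨(⟨i, hi⟩, ⟨j, hj⟩), ?_⟩
      rw [QuotientGroup.eq]
      -- `r⁻¹ γ = r⁻¹ (γ r⁻¹) r ∈ B` by normality
      set r : ↥grigorchukGroup := (aG * dG) ^ i * aG ^ j
      have e : r⁻¹ * γ = r⁻¹ * (γ * r⁻¹) * r⁻¹⁻¹ := by group
      rw [e]
      exact Subgroup.Normal.conj_mem inferInstance _ h r⁻¹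
  exact Subgroup.finiteIndex_of_finite_quotient

/-! ## §5 The rigid stabilisers are finitely generated and infinite -/

/-- The range of `secR i` has finite index in `𝔊` (it contains `B`). [cite: MuchnikPak2001, Lemma 2] -/
theorem range_secR_finiteIndex (i : Bool) : (secR i).range.FiniteIndex := by
  haveI := normalClosureB_finiteIndex
  exact Subgroup.finiteIndex_of_le (normalClosureB_le_range_secR i)

/-- **The rigid stabiliser `ristG i` is FINITELY GENERATED** (`≅ range (secR i)`, a finite-index subgroup of the finitely generated `𝔊` — Schreier).
[cite: MuchnikPak2001, Lemma 2 / Cor. 1 (the factors are finitely generated)] -/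
theorem ristG_fg (i : Bool) : (ristG i).FG := by
  haveI : Group.FG ↥grigorchukGroup := by
    show Group.FG ↥(Subgroup.closure ({genA, genB, genC, genD} : Set (Equiv.Perm Ray)))
    infer_instance
  haveI := range_secR_finiteIndex i
  haveI : Group.FG ↥(secR i).range := Subgroup.fg_of_index_ne_zero _
  rw [← Group.fg_iff_subgroup_fg]
  let e := MonoidHom.ofInjective (secR_injective i)
  exact Group.fg_of_surjective (f := e.symm.toMonoidHom) fun y => ⟨e y, e.symm_apply_apply y⟩

/-- **The rigid stabiliser `ristG i` is INFINITE** (`≅` a finite-index subgroup of the infinite group `𝔊`, p594312).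
[cite: MuchnikPak2001, Lemma 2 / Cor. 1 (the factors are infinite)] [cite: Grigorchuk1980, 𝔊 is infinite] -/
theorem ristG_infinite (i : Bool) : ((ristG i : Subgroup ↥grigorchukGroup) : Set ↥grigorchukGroup).Infinite := by
  haveI : Infinite ↥grigorchukGroup := Set.infinite_coe_iff.2 grigorchukGroup_infinite
  haveI := range_secR_finiteIndex i
  -- a finite-index subgroup of an infinite group is infinite
  have hR : Infinite ↥(secR i).range := by
    by_contra hfin
    rw [not_infinite_iff_finite] at hfin
    haveI : Finite ↥grigorchukGroup := by
      refine Nat.finite_of_card_ne_zero ?_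
      rw [← (secR i).range.index_mul_card]
      exact Nat.mul_ne_zero Subgroup.FiniteIndex.index_ne_zero (Nat.card_pos (α := ↥(secR i).range)).ne'
    exact not_finite ↥grigorchukGroup
  rw [← Set.infinite_coe_iff]
  haveI := hR
  let e := MonoidHom.ofInjective (secR_injective i)
  exact Infinite.of_injective (fun y => e.symm y) e.symm.injective

end Grigorchuk

end Summit.CriticalPhenomena.PercolationContinuityZ3.Theorems.Transplant

end
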